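import Literature.NumberTheory.Automorphic.TateLocalFactors
import Literature.RepresentationTheory.SeesawScalarCharacter
import Mathlib.MeasureTheory.Integral.Lebesgue.Basic
import Mathlib.MeasureTheory.Measure.OpenPos
import Mathlib.RepresentationTheory.Basic
import HarnessLib

/-!
# The `L²` norm on Schwartz–Bruhat functions; two `L²`-isometric actions that differ by a character differ by a
# UNITARY character

Topic `NumberTheory/Automorphic`; namespace `Literature.NumberTheory.Automorphic` (that of the tree's
`SchwartzBruhat`, `TateLocalFactors.lean`).  KERNEL ONLY: two definitions with bodies and proved theorems; no named fact,
no record, no `sorry`.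

For a topological space `X` with a measure `ν` (intended: `X = F_vᴺ` for a non-archimedean local field `F_v` with a Haar
measure, the carrier of the smooth Schrödinger model `𝒮(F_vᴺ)` of [MoeglinVignerasWaldspurger1987, Chap. 2 I.4 / II.1]):

* §1 `SchwartzBruhat.l2NormSq ν Φ = ∫⁻ ‖Φ x‖² dν` (an extended non-negative real), with `l2NormSq_smul`
  (`‖c • Φ‖² = |c|² ‖Φ‖²`), **`l2NormSq_pos`** (`Φ ≠ 0 ⇒ ‖Φ‖² > 0` when `ν` charges non-empty open sets: `Φ` is locally
  constant, so it is a non-zero constant on a non-empty OPEN set) and **`l2NormSq_lt_top`** (`Φ` is bounded with compact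
  support, `ν` finite on compacts) — i.e. `𝒮(X) ⊆ L²(X, ν)` with the restricted norm POSITIVE DEFINITE
  ([Weil1964, Chap. I n° 11]: the Schwartz–Bruhat space is a dense subspace of `L²`);
* §2 `Representation.IsL2Isometric ν ρ`: every `ρ g` preserves `l2NormSq ν` (the UNITARITY of an action on `𝒮(X)` for the
  `L²(ν)` inner product, stated on the norm); stable under composition with a homomorphism (`IsL2Isometric.comp`);
* §3 the abstract lemma **`norm_eq_one_of_twist_of_normSq`**: if two actions `ρ, ρ'` of a group on a `ℂ`-space both
  preserve a functional `𝒩` with `𝒩(c • f) = |c|² 𝒩(f)` that is non-zero and finite at one vector, and `ρ' = η • ρ` for a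
  character `η`, then `|η(g)| = 1` for all `g`; whence **`Representation.IsL2Isometric.norm_eq_one_of_twist`**: two
  `L²`-ISOMETRIC representations on `𝒮(X) ≠ 0` that differ by a character `η` (`ρ' = SeesawScalar.twist η ρ`) differ by a
  UNITARY character.

Use (Hodge/COR-CM cell, Track 2 of the per-place cite `hD1` = [Liu2021, App. D Lem. D.1 (1)]): two local splittings of
`U(J)(F_v)` into `S̃p_{ψ_v}(𝕎_v)` give local Weil representations `ω'_v = η_v • ω_v`
(`GelbartRogawski1991/LocalSplittingsDifferByCharacter.lean`); the as-printed reading of Lemma D.1 (1) passes between them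
when `η_v` is unitary on the centre (`Liu2021/LemD1DataOfPlaceTwist.lean`), which is automatic at a non-split place and, by
the present file, holds at EVERY place as soon as both Weil representations are unitary (`L²`-isometric on `𝒮(F_vᴺ)`) —
`Liu2021/LemD1DataOfPlaceIsometric.lean`.  Nothing of [Liu2021] or [GelbartRogawski1991] is asserted here.

## References
* [Weil1964] A. Weil, *Sur certains groupes d'opérateurs unitaires*, Acta Math. 111 (1964) 143–211, Chap. I n° 11–13
  (Schwartz–Bruhat functions inside `L²`, unitarity of the operators of the metaplectic group).
* [GelbartRogawski1991] S. Gelbart, J. Rogawski, Invent. Math. 105 (1991), §3.1 Remark p. 457 L4–13 (two splittings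
  differ by a central character).
* [MoeglinVignerasWaldspurger1987] C. Mœglin, M.-F. Vignéras, J.-L. Waldspurger, LNM 1291 (1987), Chap. 2 I.3–I.4, II.1.
* [BushnellHenniart2006] C. J. Bushnell, G. Henniart, *The local Langlands conjecture for GL(2)*, §23.1 (Schwartz–Bruhat
  functions: locally constant, compactly supported).
-/

set_option autoImplicit false

noncomputable section

open _root_.MeasureTheory _root_.MeasureTheory.Measure Set
open scoped ENNReal NNReal

namespace Literature.NumberTheory.Automorphic

/-! ## §1 The `L²` norm (squared) of a Schwartz–Bruhat function -/

namespace SchwartzBruhat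

variable {X : Type*} [TopologicalSpace X] [MeasurableSpace X] (ν : Measure X)

/-- **`‖Φ‖²_{L²(ν)} = ∫ |Φ(x)|² dν(x)`** for a Schwartz–Bruhat function `Φ` on `X`, as an extended non-negative real
(finite under `l2NormSq_lt_top`). [cite: Weil1964, Chap. I n° 11] -/
def l2NormSq (Φ : SchwartzBruhat X) : ℝ≥0∞ := ∫⁻ x, ‖(Φ : X → ℂ) x‖ₑ ^ 2 ∂ν

/-- unfolding. [cite: Weil1964, Chap. I n° 11] -/
theorem l2NormSq_def (Φ : SchwartzBruhat X) : l2NormSq ν Φ = ∫⁻ x, ‖(Φ : X → ℂ) x‖ₑ ^ 2 ∂ν := rfl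

/-- `‖0‖² = 0`. [cite: Weil1964, Chap. I n° 11] -/
@[simp] theorem l2NormSq_zero : l2NormSq ν (0 : SchwartzBruhat X) = 0 := by
  simp [l2NormSq]

/-- **homogeneity**: `‖c • Φ‖² = |c|² ‖Φ‖²`. [cite: Weil1964, Chap. I n° 11] -/
theorem l2NormSq_smul (c : ℂ) (Φ : SchwartzBruhat X) : l2NormSq ν (c • Φ) = ‖c‖ₑ ^ 2 * l2NormSq ν Φ := by
  rw [l2NormSq, l2NormSq, ← lintegral_const_mul' _ _ (ENNReal.pow_ne_top enorm_ne_top)]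
  refine lintegral_congr fun x => ?_
  rw [Submodule.coe_smul, Pi.smul_apply, smul_eq_mul, enorm_mul, mul_pow]

/-- **positivity**: if `ν` charges every non-empty open set then `‖Φ‖² > 0` for `Φ ≠ 0` — a Schwartz–Bruhat function is
locally constant, so a non-zero one equals a non-zero constant on a non-empty open set. [cite: Weil1964, Chap. I n° 11] -/
theorem l2NormSq_pos [OpensMeasurableSpace X] [ν.IsOpenPosMeasure] {Φ : SchwartzBruhat X} (hΦ : Φ ≠ 0) :
    0 < l2NormSq ν Φ := by
  have hΦ' : (Φ : X → ℂ) ≠ 0 := fun h => hΦ (Subtype.ext h)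
  obtain ⟨x₀, hx₀⟩ := Function.ne_iff.1 hΦ'
  set U : Set X := {x | (Φ : X → ℂ) x = (Φ : X → ℂ) x₀} with hU
  have hUo : IsOpen U := Φ.2.1.isOpen_fiber _
  have hUm : MeasurableSet U := hUo.measurableSet
  have hUpos : 0 < ν U := hUo.measure_pos ν ⟨x₀, rfl⟩
  have h1 : ‖(Φ : X → ℂ) x₀‖ₑ ^ 2 * ν U ≤ l2NormSq ν Φ := by
    calc ‖(Φ : X → ℂ) x₀‖ₑ ^ 2 * ν U = ∫⁻ _ in U, ‖(Φ : X → ℂ) x₀‖ₑ ^ 2 ∂ν := (setLIntegral_const U _).symm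
      _ = ∫⁻ x in U, ‖(Φ : X → ℂ) x‖ₑ ^ 2 ∂ν := by
          refine setLIntegral_congr_fun hUm ?_
          intro x hx
          change ‖(Φ : X → ℂ) x₀‖ₑ ^ 2 = ‖(Φ : X → ℂ) x‖ₑ ^ 2
          rw [show (Φ : X → ℂ) x = (Φ : X → ℂ) x₀ from hx]
      _ ≤ l2NormSq ν Φ := setLIntegral_le_lintegral U _
  refine lt_of_lt_of_le ?_ h1
  exact ENNReal.mul_pos (pow_ne_zero 2 (enorm_ne_zero.2 hx₀)) hUpos.ne'

/-- **finiteness**: if `ν` is finite on compact sets then `‖Φ‖² < ∞` — `Φ` is bounded (continuous with compact support)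
and vanishes off the compact set `tsupport Φ`. [cite: Weil1964, Chap. I n° 11] -/
theorem l2NormSq_lt_top [IsFiniteMeasureOnCompacts ν] (Φ : SchwartzBruhat X) : l2NormSq ν Φ < ∞ := by
  have hcont : Continuous (Φ : X → ℂ) := Φ.2.1.continuous
  obtain ⟨C, hC⟩ := hcont.bounded_above_of_compact_support Φ.2.2
  set K : Set X := tsupport (Φ : X → ℂ) with hK
  have hKc : IsCompact K := Φ.2.2
  have hpt : ∀ x, ‖(Φ : X → ℂ) x‖ₑ ^ 2 ≤ K.indicator (fun _ => ENNReal.ofReal C ^ 2) x := by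
    intro x
    by_cases hx : x ∈ K
    · rw [Set.indicator_of_mem hx]
      have h1 : ‖(Φ : X → ℂ) x‖ₑ ≤ ENNReal.ofReal C := by
        rw [← ofReal_norm]
        exact ENNReal.ofReal_le_ofReal (hC x)
      exact pow_le_pow_left' h1 2
    · rw [Set.indicator_of_notMem hx, image_eq_zero_of_notMem_tsupport hx, enorm_zero, zero_pow two_ne_zero]
  calc l2NormSq ν Φ ≤ ∫⁻ x, K.indicator (fun _ => ENNReal.ofReal C ^ 2) x ∂ν := lintegral_mono hpt
    _ ≤ ENNReal.ofReal C ^ 2 * ν K := lintegral_indicator_const_le _ _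
    _ < ∞ := ENNReal.mul_lt_top (ENNReal.pow_lt_top ENNReal.ofReal_lt_top) hKc.measure_lt_top

/-- hence `‖Φ‖² ≠ ∞`. [cite: Weil1964, Chap. I n° 11] -/
theorem l2NormSq_ne_top [IsFiniteMeasureOnCompacts ν] (Φ : SchwartzBruhat X) : l2NormSq ν Φ ≠ ∞ :=
  (l2NormSq_lt_top ν Φ).ne

end SchwartzBruhat

/-! ## §2 `L²`-isometric actions on `𝒮(X)` -/

/-- **An action of `G` on `𝒮(X)` is `L²(ν)`-ISOMETRIC** when every `ρ g` preserves `‖·‖²_{L²(ν)}` — unitarity of the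
action for the `L²(X, ν)` inner product, stated on the norm (which suffices on a complex pre-Hilbert space by
polarisation; only the norm form is used).  DELIBERATE DOT-NOTATION EXTENSION of Mathlib's `Representation` namespace.
[cite: Weil1964, Chap. I n° 13] -/
def _root_.Representation.IsL2Isometric {G : Type*} [Monoid G] {X : Type*} [TopologicalSpace X] [MeasurableSpace X]
    (ν : Measure X) (ρ : Representation ℂ G (SchwartzBruhat X)) : Prop :=
  ∀ (g : G) (Φ : SchwartzBruhat X), SchwartzBruhat.l2NormSq ν (ρ g Φ) = SchwartzBruhat.l2NormSq ν Φ

section IsL2Isometric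

variable {G : Type*} [Monoid G] {X : Type*} [TopologicalSpace X] [MeasurableSpace X] {ν : Measure X}
  {ρ : Representation ℂ G (SchwartzBruhat X)}

/-- unfolding. [cite: Weil1964, Chap. I n° 13] -/
theorem _root_.Representation.IsL2Isometric.l2NormSq_apply (h : ρ.IsL2Isometric ν) (g : G) (Φ : SchwartzBruhat X) :
    SchwartzBruhat.l2NormSq ν (ρ g Φ) = SchwartzBruhat.l2NormSq ν Φ :=
  h g Φ

/-- an `L²`-isometric action pulled back along a homomorphism is `L²`-isometric (unitary operators restricted to a
subgroup / pulled back along a splitting stay unitary). [cite: Weil1964, Chap. I n° 13] -/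
theorem _root_.Representation.IsL2Isometric.comp (h : ρ.IsL2Isometric ν) {H : Type*} [Monoid H] (f : H →* G) :
    Representation.IsL2Isometric ν (ρ.comp f) :=
  fun g Φ => h (f g) Φ

end IsL2Isometric

/-! ## §3 Two norm-preserving actions that differ by a character differ by a unitary character -/

section Twist

open Literature.RepresentationTheory (SeesawScalar.twist SeesawScalar.twist_apply)

/-- `|c|ₑ² = 1 ⇒ |c| = 1` for a complex number (bookkeeping between `ℝ≥0∞`, `ℝ≥0` and `ℝ`). [folklore] -/
private theorem norm_eq_one_of_enorm_sq_eq_one {c : ℂ} (h : ‖c‖ₑ ^ 2 = 1) : ‖c‖ = 1 := by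
  have h3 : (‖c‖₊ : ℝ≥0) ^ 2 = 1 := by
    rw [enorm_eq_nnnorm, ← ENNReal.coe_pow, ENNReal.coe_eq_one] at h
    exact h
  have h4 : ‖c‖ ^ 2 = 1 := by
    have := congrArg (fun t : ℝ≥0 => (t : ℝ)) h3
    simpa only [NNReal.coe_pow, coe_nnnorm, NNReal.coe_one] using this
  exact (pow_eq_one_iff_of_nonneg (norm_nonneg _) two_ne_zero).1 h4

/-- **Abstract form.**  Let `𝒩 : S → [0, ∞]` satisfy `𝒩(c • f) = |c|² 𝒩(f)` and be non-zero and finite at some `f₀`.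
If two actions `ρ, ρ'` of `G` on `S` both preserve `𝒩` and `ρ'(g) f = η(g) • ρ(g) f` for a function `η : G → ℂˣ`, then
`|η(g)| = 1` for every `g`: `𝒩(f₀) = 𝒩(ρ' g f₀) = |η g|² 𝒩(ρ g f₀) = |η g|² 𝒩(f₀)` — the norm form of «any other
splitting is `s ⊗ ν'` with `ν'` a (unitary) character into the central `ℂ*`». [cite: GelbartRogawski1991, §3.1 Remark p. 457 L4–13] -/
theorem norm_eq_one_of_twist_of_normSq {G S : Type*} [Monoid G] [AddCommGroup S] [Module ℂ S] (𝒩 : S → ℝ≥0∞)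
    (h𝒩 : ∀ (c : ℂ) (f : S), 𝒩 (c • f) = ‖c‖ₑ ^ 2 * 𝒩 f) {f₀ : S} (h0 : 𝒩 f₀ ≠ 0) (htop : 𝒩 f₀ ≠ ∞)
    (ρ ρ' : Representation ℂ G S) (hρ : ∀ g f, 𝒩 (ρ g f) = 𝒩 f) (hρ' : ∀ g f, 𝒩 (ρ' g f) = 𝒩 f)
    (η : G → ℂˣ) (hη : ∀ g f, ρ' g f = ((η g : ℂˣ) : ℂ) • ρ g f) (g : G) : ‖((η g : ℂˣ) : ℂ)‖ = 1 := by
  have h1 : ‖((η g : ℂˣ) : ℂ)‖ₑ ^ 2 * 𝒩 f₀ = 1 * 𝒩 f₀ := by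
    rw [one_mul]
    conv_rhs => rw [← hρ' g f₀, hη g f₀, h𝒩, hρ g f₀]
  exact norm_eq_one_of_enorm_sq_eq_one ((ENNReal.mul_left_inj h0 htop).1 h1)

variable {G : Type*} [Monoid G] {X : Type*} [TopologicalSpace X] [MeasurableSpace X] {ν : Measure X}

/-- **Two `L²`-isometric representations on `𝒮(X) ≠ 0` that differ by a character differ by a UNITARY character**:
if `ρ, ρ'` are `L²(ν)`-isometric (`ν` charging non-empty open sets and finite on compacts) and
`ρ' = η • ρ` (`SeesawScalar.twist`), then `|η(g)| = 1` for all `g ∈ G`.  In the model case ([GelbartRogawski1991, §3.1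
Remark p. 457]: two splittings of the metaplectic cover over `U(V)` differ by a central character `ν'`), `ν'` is unitary
as soon as both pulled-back Weil representations are. [cite: Weil1964, Chap. I n° 13] -/
theorem _root_.Representation.IsL2Isometric.norm_eq_one_of_twist [OpensMeasurableSpace X] [ν.IsOpenPosMeasure]
    [IsFiniteMeasureOnCompacts ν] [Nontrivial (SchwartzBruhat X)] {ρ ρ' : Representation ℂ G (SchwartzBruhat X)}
    (hρ : ρ.IsL2Isometric ν) (hρ' : ρ'.IsL2Isometric ν) (η : G →* ℂˣ) (hη : ρ' = SeesawScalar.twist η ρ) (g : G) :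
    ‖((η g : ℂˣ) : ℂ)‖ = 1 := by
  obtain ⟨Φ₀, hΦ₀⟩ := exists_ne (0 : SchwartzBruhat X)
  have h0 : SchwartzBruhat.l2NormSq ν Φ₀ ≠ 0 := (SchwartzBruhat.l2NormSq_pos ν hΦ₀).ne'
  have htop : SchwartzBruhat.l2NormSq ν Φ₀ ≠ ∞ := SchwartzBruhat.l2NormSq_ne_top ν Φ₀
  have h1 : ‖((η g : ℂˣ) : ℂ)‖ₑ ^ 2 * SchwartzBruhat.l2NormSq ν Φ₀ = 1 * SchwartzBruhat.l2NormSq ν Φ₀ := by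
    rw [one_mul]
    conv_rhs => rw [← hρ' g Φ₀, hη, SeesawScalar.twist_apply, SchwartzBruhat.l2NormSq_smul, hρ g Φ₀]
  exact norm_eq_one_of_enorm_sq_eq_one ((ENNReal.mul_left_inj h0 htop).1 h1)

/-- the same with the twist given pointwise. [cite: Weil1964, Chap. I n° 13] -/
theorem _root_.Representation.IsL2Isometric.norm_eq_one_of_twist_apply [OpensMeasurableSpace X] [ν.IsOpenPosMeasure]
    [IsFiniteMeasureOnCompacts ν] [Nontrivial (SchwartzBruhat X)] {ρ ρ' : Representation ℂ G (SchwartzBruhat X)}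
    (hρ : ρ.IsL2Isometric ν) (hρ' : ρ'.IsL2Isometric ν) (η : G → ℂˣ)
    (hη : ∀ (g : G) (Φ : SchwartzBruhat X), ρ' g Φ = ((η g : ℂˣ) : ℂ) • ρ g Φ) (g : G) :
    ‖((η g : ℂˣ) : ℂ)‖ = 1 := by
  obtain ⟨Φ₀, hΦ₀⟩ := exists_ne (0 : SchwartzBruhat X)
  have h0 : SchwartzBruhat.l2NormSq ν Φ₀ ≠ 0 := (SchwartzBruhat.l2NormSq_pos ν hΦ₀).ne'
  have htop : SchwartzBruhat.l2NormSq ν Φ₀ ≠ ∞ := SchwartzBruhat.l2NormSq_ne_top ν Φ₀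
  have h1 : ‖((η g : ℂˣ) : ℂ)‖ₑ ^ 2 * SchwartzBruhat.l2NormSq ν Φ₀ = 1 * SchwartzBruhat.l2NormSq ν Φ₀ := by
    rw [one_mul]
    conv_rhs => rw [← hρ' g Φ₀, hη, SchwartzBruhat.l2NormSq_smul, hρ g Φ₀]
  exact norm_eq_one_of_enorm_sq_eq_one ((ENNReal.mul_left_inj h0 htop).1 h1)

/-- conversely, a twist of an `L²`-isometric representation by a UNITARY character is `L²`-isometric (`s ⊗ ν'` is again a
unitary splitting for unitary `ν'`). [cite: GelbartRogawski1991, §3.1 Remark p. 457 L4–13] -/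
theorem _root_.Representation.IsL2Isometric.twist {ρ : Representation ℂ G (SchwartzBruhat X)} (hρ : ρ.IsL2Isometric ν)
    (η : G →* ℂˣ) (hη : ∀ g, ‖((η g : ℂˣ) : ℂ)‖ = 1) : (SeesawScalar.twist η ρ).IsL2Isometric ν := by
  intro g Φ
  rw [SeesawScalar.twist_apply, SchwartzBruhat.l2NormSq_smul, hρ g Φ]
  have : ‖((η g : ℂˣ) : ℂ)‖ₑ = 1 := by
    rw [← ofReal_norm, hη g, ENNReal.ofReal_one]
  rw [this, one_pow, one_mul]

end Twist

end Literature.NumberTheory.Automorphic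

end
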